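import Summits.QuantumAdvantage.QuantumAdvantage.Theorems.AnchorDialPointer
import Summits.QuantumAdvantage.QuantumAdvantage.Theorems.HolonomyDialOrbit

/-!
# AnchorDial — Frozen (cell decomp-qadv, seat lens-2, generation 14; supports item 26531 `ExactnessDial.PolyLossOddU3`)

§3 + §5 of the node: LEVEL 0 of the sensitivity dial is a THEOREM — walk bookkeeping under an adjacent pair-flip (`Wk_flipAdj`,
`cN_flipAdj`: every kernel phase moves by the flip's sign, doubled past the flip), exclusion parity (`three_counts`, `parity_core`),
**`frozen_orbit_loses`** (a strategy whose deviation set is frozen along the orbit of two far pair-flips and lies in one gap loses at one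
of the four points — every strategy, no degree bound) and **`frozen_loss_count`** (#frozen-one-gap odd inputs ≤ 4·#losers); the reflection
law `relPhase_not` / `win_reflect` (the hidden parity bit reflects the avoided value, `a ↦ 1 − a`); §6 gauge notes (doc only).

Split (≤ 400 lines, part 3/3) of the node file `HOME/decomp-qadv-lens-2/g14/AnchorDial.lean` (sha256 a954f04b…, farm rc 0, no
placeholders); declarations verbatim, namespace `Summit.QuantumAdvantage.QuantumAdvantage.Theorems.AnchorDial`.  Record: NODE-g14.md.
-/

set_option linter.dupNamespace false
set_option linter.unusedVariables false

noncomputable section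

open scoped Classical

namespace Summit.QuantumAdvantage.QuantumAdvantage.Theorems.AnchorDial

open Finset
open Literature.Computability.QuantumComplexity Literature.Computability.QuantumComplexity.RingHLF
open Literature.Computability.MetaComplexity Literature.Computability.MetaComplexity.Smolensky
open Summit.QuantumAdvantage.AdviceFreeQNC0
open Summit.QuantumAdvantage.QuantumAdvantage.Theses (ExactnessDial.PolyLossOddU3 ExactnessDial.DPLift3)
-- only the tree gadgets we use (the g13 package keeps landing under `Theorems.HolonomyDial`; no blanket `open`)
open Summit.QuantumAdvantage.QuantumAdvantage.Theorems.HolonomyDial (gCond selP selP_mem selP_apply xorP xorP_mem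
  xorP_apply_bool tPoly tPoly_mem tPoly_apply BinPtrWin BinPointerLoss3 HolDecodeLoss3 holDecodeLoss3_of_binPointerLoss3
  closes_T)

variable {N : ℕ}

/-! ## §3 Level 0 of the dial is a THEOREM: a bet frozen under two far pair-flips loses a quarter of its orbits
(every strategy, no degree hypothesis) -/

section Frozen

/-- walk locality (vendored from g13 §K). -/
theorem walk_agree (x x' : Fin N → Bool) (b K : ℕ) (hK : K ≤ N) (hpar : zpar x b = zpar x' b)
    (hag : ∀ j : Fin N, b ≤ j.val → j.val < K → x j = x' j) :
    ∀ k, b ≤ k → k ≤ K → zpar x k = zpar x' k ∧ Wk x k + Wk x' b = Wk x' k + Wk x b := by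
  intro k hbk hkK
  induction k, hbk using Nat.le_induction with
  | base => exact ⟨hpar, by rw [add_comm]⟩
  | succ k hbk ih =>
    have hk : k < N := by omega
    obtain ⟨ihz, ihW⟩ := ih (by omega)
    have hxk : x ⟨k, hk⟩ = x' ⟨k, hk⟩ := hag ⟨k, hk⟩ hbk (by simp only; omega)
    have hz : zpar x (k + 1) = zpar x' (k + 1) := by
      rw [zpar_succ x hk, zpar_succ x' hk, ihz, hxk]
    refine ⟨hz, ?_⟩
    rw [Wk_succ x hk, Wk_succ x' hk, uCoord_eq_zpar, uCoord_eq_zpar]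
    simp only [hz]
    omega

/-- **weights under the adjacent pair-flip at `(a, a+1)`**: unchanged up to `a`, shifted by `1 - 2[zpar x (a+1)]`
from `a + 1` on (an identity in `ℕ`). -/
theorem Wk_flipAdj (x : Fin N → Bool) {a : ℕ} (ha : a + 2 ≤ N) (k : ℕ) (hk : k ≤ N) :
    Wk (flip2 a (a + 1) x) k + (if a + 1 ≤ k then 2 * (if zpar x (a + 1) then 1 else 0) else 0) =
      Wk x k + (if a + 1 ≤ k then 1 else 0) := by
  set y := flip2 a (a + 1) x with hy
  have hz := zpar_flip2 (show a < a + 1 by omega) x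
  have hpre := HolonomyDial.Wk_eq_of_agree_prefix y x a (by omega) (fun j hj => flip2_apply_of_ne x (by omega) (by omega))
  by_cases hk1 : a + 1 ≤ k
  · rw [if_pos hk1, if_pos hk1]
    have s1y : Wk y (a + 1) = Wk y a + (if zpar y (a + 1) = true then 1 else 0) := by
      rw [Wk_succ y (k := a) (by omega), uCoord_eq_zpar]
    have s1x : Wk x (a + 1) = Wk x a + (if zpar x (a + 1) = true then 1 else 0) := by
      rw [Wk_succ x (k := a) (by omega), uCoord_eq_zpar]
    have z1 : zpar y (a + 1) = !zpar x (a + 1) := by rw [hz (a + 1) (by omega), if_pos (by omega)]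
    have ea : Wk y a = Wk x a := (hpre a le_rfl).2
    by_cases hk2 : k = a + 1
    · rw [hk2, s1y, s1x, z1, ea]
      cases zpar x (a + 1) <;> simp
    have z2 : zpar y (a + 2) = zpar x (a + 2) := by rw [hz (a + 2) (by omega), if_neg (by omega)]
    have hag := (walk_agree y x (a + 2) k hk z2
      (fun j hj _ => flip2_apply_of_ne x (by omega) (by omega)) k (by omega) le_rfl).2
    have s2y : Wk y (a + 2) = Wk y (a + 1) + (if zpar y (a + 2) = true then 1 else 0) := by
      rw [Wk_succ y (k := a + 1) (by omega), uCoord_eq_zpar]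
    have s2x : Wk x (a + 2) = Wk x (a + 1) + (if zpar x (a + 2) = true then 1 else 0) := by
      rw [Wk_succ x (k := a + 1) (by omega), uCoord_eq_zpar]
    rw [z2] at s2y
    rw [z1, ea] at s1y
    cases h1 : zpar x (a + 1) <;> cases h2 : zpar x (a + 2) <;> simp [h1, h2] at s1y s1x s2y s2x ⊢ <;> omega
  · rw [if_neg hk1, if_neg hk1, add_zero, add_zero]
    exact (hpre k (by omega)).2

/-- the sign of a pair-flip as a shift `mod 3`: `1` if `zpar x (a+1) = false`, `2` if `true`. -/
def sgN (z : Bool) : ℕ := if z then 2 else 1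

/-- **kernel phases under an adjacent pair-flip**: every phase `c_k` moves by the flip's SIGN `σ ∈ {1,2}`, doubled
when the position is past the flip (`k ≥ a+1`): `c_k(f x) ≡ c_k(x) + (1 + [a+1 ≤ k])·σ (mod 3)`. -/
theorem cN_flipAdj (x : Fin N → Bool) {a : ℕ} (ha : a + 3 ≤ N) (k : ℕ) (hk : k ≤ N) :
    cN (flip2 a (a + 1) x) k % 3 = (cN x k + (if a + 1 ≤ k then 2 else 1) * sgN (zpar x (a + 1))) % 3 := by
  have h1 := Wk_flipAdj x (show a + 2 ≤ N by omega) k hk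
  have h2 := Wk_flipAdj x (show a + 2 ≤ N by omega) (N - 1) (by omega)
  rw [if_pos (show a + 1 ≤ N - 1 by omega), if_pos (show a + 1 ≤ N - 1 by omega)] at h2
  unfold cN sgN
  by_cases hk1 : a + 1 ≤ k
  · rw [if_pos hk1, if_pos hk1] at h1
    rw [if_pos hk1]
    cases hu : zpar x (a + 1) <;> simp only [hu, if_true, if_false, Bool.false_eq_true, mul_one, mul_zero] at h1 h2 ⊢ <;> omega
  · rw [if_neg hk1, if_neg hk1] at h1
    rw [if_neg hk1]
    cases hu : zpar x (a + 1) <;> simp only [hu, if_true, if_false, Bool.false_eq_true, mul_one, mul_zero] at h1 h2 ⊢ <;> omega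

/-- exclusion parity: over the three shifts, every position is a kernel position exactly twice. -/
theorem three_counts {α : Type*} (w : Finset α) (c : α → ℕ) :
    (w.filter fun k => (c k + 0) % 3 ≠ 2).card + (w.filter fun k => (c k + 1) % 3 ≠ 2).card +
      (w.filter fun k => (c k + 2) % 3 ≠ 2).card = 2 * w.card := by
  rw [card_filter, card_filter, card_filter, ← sum_add_distrib, ← sum_add_distrib, card_eq_sum_ones, mul_sum]
  refine sum_congr rfl fun k _ => ?_
  have : c k % 3 < 3 := Nat.mod_lt _ (by norm_num)
  split_ifs <;> omega

/-- the parity core of the frozen law: four winning orbit points with shifts `0, s₁, s₂, s₁+s₂` (`s_i ≢ 0`)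
contradict exclusion parity. -/
theorem parity_core (n : ℕ → ℕ) (m s₁ s₂ : ℕ) (hper : ∀ t, n t = n (t % 3))
    (hsum : n 0 + n 1 + n 2 = 2 * m) (hs₁ : s₁ % 3 ≠ 0) (hs₂ : s₂ % 3 ≠ 0)
    (o₀ : n 0 % 2 = 1) (o₁ : n s₁ % 2 = 1) (o₂ : n s₂ % 2 = 1) (o₃ : n (s₁ + s₂) % 2 = 1) : False := by
  rw [hper s₁] at o₁
  rw [hper s₂] at o₂
  rw [hper (s₁ + s₂)] at o₃
  rcases (by omega : s₁ % 3 = 1 ∨ s₁ % 3 = 2) with h1 | h1 <;>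
    rcases (by omega : s₂ % 3 = 1 ∨ s₂ % 3 = 2) with h2 | h2
  · rw [h1] at o₁; rw [h2] at o₂; rw [show (s₁ + s₂) % 3 = 2 by omega] at o₃; omega
  · rw [h1] at o₁; rw [h2] at o₂; omega
  · rw [h1] at o₁; rw [h2] at o₂; omega
  · rw [h1] at o₁; rw [h2] at o₂; rw [show (s₁ + s₂) % 3 = 1 by omega] at o₃; omega

/-- the deviation set is FROZEN along the `Z₂²`-orbit of the two pair-flips at `(a₁, a₁+1)`, `(a₂, a₂+1)`. -/
def Frozen (P : Fin N → CubeFn (ZMod 3) N) (a₁ a₂ : ℕ) (x : Fin N → Bool) : Prop :=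
  dev P (flip2 a₁ (a₁ + 1) x) = dev P x ∧ dev P (flip2 a₂ (a₂ + 1) x) = dev P x ∧
    dev P (flip2 a₁ (a₁ + 1) (flip2 a₂ (a₂ + 1) x)) = dev P x

/-- the deviation set lies in ONE of the three gaps cut by the two flips. -/
def OneGap (P : Fin N → CubeFn (ZMod 3) N) (a₁ a₂ : ℕ) (x : Fin N → Bool) : Prop :=
  (∀ i ∈ dev P x, i.val ≤ a₁) ∨ (∀ i ∈ dev P x, a₁ + 1 ≤ i.val ∧ i.val ≤ a₂) ∨ (∀ i ∈ dev P x, a₂ + 1 ≤ i.val)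

/-- the frozen law with explicit gap multipliers `C₁, C₂ ∈ {1,2}`. -/
theorem frozen_orbit_loses_aux (hN : 3 ≤ N) {a₁ a₂ : ℕ} (h12 : a₁ + 2 ≤ a₂) (h2N : a₂ + 3 ≤ N)
    (P : Fin N → CubeFn (ZMod 3) N) (x : Fin N → Bool) (hx : OddZeros x) (hF : Frozen P a₁ a₂ x)
    (C₁ C₂ : ℕ) (hC₁ : C₁ = 1 ∨ C₁ = 2) (hC₂ : C₂ = 1 ∨ C₂ = 2)
    (hg₁ : ∀ i ∈ dev P x, (if a₁ + 1 ≤ i.val then 2 else 1) = C₁)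
    (hg₂ : ∀ i ∈ dev P x, (if a₂ + 1 ≤ i.val then 2 else 1) = C₂) :
    ¬ (Rel x (outB P x) ∧ Rel (flip2 a₁ (a₁ + 1) x) (outB P (flip2 a₁ (a₁ + 1) x)) ∧
       Rel (flip2 a₂ (a₂ + 1) x) (outB P (flip2 a₂ (a₂ + 1) x)) ∧
       Rel (flip2 a₁ (a₁ + 1) (flip2 a₂ (a₂ + 1) x)) (outB P (flip2 a₁ (a₁ + 1) (flip2 a₂ (a₂ + 1) x)))) := by
  rintro ⟨w₀, w₁, w₂, w₃⟩
  obtain ⟨hF₁, hF₂, hF₃⟩ := hF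
  set y₁ := flip2 a₁ (a₁ + 1) x with hy₁
  set y₂ := flip2 a₂ (a₂ + 1) x with hy₂
  set y₃ := flip2 a₁ (a₁ + 1) y₂ with hy₃
  have ho₁ : OddZeros y₁ := (oddZeros_flip2 (by omega) (by omega) x).2 hx
  have ho₂ : OddZeros y₂ := (oddZeros_flip2 (by omega) (by omega) x).2 hx
  have ho₃ : OddZeros y₃ := (oddZeros_flip2 (by omega) (by omega) y₂).2 ho₂
  rw [win_iff hN P x hx] at w₀
  rw [win_iff hN P y₁ ho₁, hF₁] at w₁
  rw [win_iff hN P y₂ ho₂, hF₂] at w₂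
  rw [win_iff hN P y₃ ho₃, hF₃] at w₃
  set w := dev P x with hw
  set u₁ := zpar x (a₁ + 1) with hu₁
  set u₂ := zpar x (a₂ + 1) with hu₂
  have hu₁' : zpar y₂ (a₁ + 1) = u₁ := by
    rw [hy₂, zpar_flip2 (show a₂ < a₂ + 1 by omega) x (a₁ + 1) (by omega), if_neg (by omega)]
  set s₁ := C₁ * sgN u₁ with hs₁
  set s₂ := C₂ * sgN u₂ with hs₂
  have hsg : ∀ z, sgN z = 1 ∨ sgN z = 2 := fun z => by cases z <;> simp [sgN]
  have hs₁0 : s₁ % 3 ≠ 0 := by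
    rcases hC₁ with h | h <;> rcases hsg u₁ with h' | h' <;> rw [hs₁, h, h'] <;> decide
  have hs₂0 : s₂ % 3 ≠ 0 := by
    rcases hC₂ with h | h <;> rcases hsg u₂ with h' | h' <;> rw [hs₂, h, h'] <;> decide
  -- the phases along the orbit
  have e₁ : ∀ k ∈ w, cN y₁ k.val % 3 = (cN x k.val + s₁) % 3 := by
    intro k hk
    rw [hy₁, cN_flipAdj x (by omega) k.val (by omega), hg₁ k hk]
  have e₂ : ∀ k ∈ w, cN y₂ k.val % 3 = (cN x k.val + s₂) % 3 := by
    intro k hk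
    rw [hy₂, cN_flipAdj x (by omega) k.val (by omega), hg₂ k hk]
  have e₃ : ∀ k ∈ w, cN y₃ k.val % 3 = (cN x k.val + s₁ + s₂) % 3 := by
    intro k hk
    have h := cN_flipAdj y₂ (show a₁ + 3 ≤ N by omega) k.val (by omega)
    rw [hg₁ k hk, hu₁'] at h
    rw [hy₃, h]
    have h' := e₂ k hk
    omega
  -- the counts
  set n : ℕ → ℕ := fun t => (w.filter fun k => (cN x k.val + t) % 3 ≠ 2).card with hn
  have hper : ∀ t, n t = n (t % 3) := by
    intro t
    simp only [hn]
    congr 1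
    refine filter_congr fun k _ => ?_
    constructor <;> intro h <;> omega
  have hsum : n 0 + n 1 + n 2 = 2 * w.card := three_counts w fun k => cN x k.val
  have o₀ : n 0 % 2 = 1 := by
    have e : (w.filter fun k => gCond x k.val) = w.filter fun k => (cN x k.val + 0) % 3 ≠ 2 :=
      filter_congr fun k _ => by rw [gCond_iff_cN, Nat.add_zero]
    simp only [hn]; rw [← e]; exact w₀
  have o₁ : n s₁ % 2 = 1 := by
    have e : (w.filter fun k => gCond y₁ k.val) = w.filter fun k => (cN x k.val + s₁) % 3 ≠ 2 :=
      filter_congr fun k hk => by rw [gCond_iff_cN, e₁ k hk]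
    simp only [hn]; rw [← e]; exact w₁
  have o₂ : n s₂ % 2 = 1 := by
    have e : (w.filter fun k => gCond y₂ k.val) = w.filter fun k => (cN x k.val + s₂) % 3 ≠ 2 :=
      filter_congr fun k hk => by rw [gCond_iff_cN, e₂ k hk]
    simp only [hn]; rw [← e]; exact w₂
  have o₃ : n (s₁ + s₂) % 2 = 1 := by
    have e : (w.filter fun k => gCond y₃ k.val) = w.filter fun k => (cN x k.val + (s₁ + s₂)) % 3 ≠ 2 :=
      filter_congr fun k hk => by rw [gCond_iff_cN, e₃ k hk, Nat.add_assoc]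
    simp only [hn]; rw [← e]; exact w₃
  exact parity_core n w.card s₁ s₂ hper hsum hs₁0 hs₂0 o₀ o₁ o₂ o₃

/-- **THE FROZEN LAW (pointwise)**: if a strategy's deviation set is the same at the four points of the orbit of two
far, disjoint adjacent pair-flips and lies in one gap, the strategy LOSES at one of the four points.  (The three
exclusion parities `#{k ∈ Dev : c_k + v ≢ 2}`, `v ∈ 𝔽₃`, sum to `2|Dev|`, so one is even; the orbit realises every
shift `v` because the two signs are non-zero.)  No degree hypothesis: level 0 of the sensitivity dial. -/
theorem frozen_orbit_loses (hN : 3 ≤ N) {a₁ a₂ : ℕ} (h12 : a₁ + 2 ≤ a₂) (h2N : a₂ + 3 ≤ N)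
    (P : Fin N → CubeFn (ZMod 3) N) (x : Fin N → Bool) (hx : OddZeros x)
    (hF : Frozen P a₁ a₂ x) (hG : OneGap P a₁ a₂ x) :
    ¬ (Rel x (outB P x) ∧ Rel (flip2 a₁ (a₁ + 1) x) (outB P (flip2 a₁ (a₁ + 1) x)) ∧
       Rel (flip2 a₂ (a₂ + 1) x) (outB P (flip2 a₂ (a₂ + 1) x)) ∧
       Rel (flip2 a₁ (a₁ + 1) (flip2 a₂ (a₂ + 1) x)) (outB P (flip2 a₁ (a₁ + 1) (flip2 a₂ (a₂ + 1) x)))) := by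
  rcases hG with hG | hG | hG
  · exact frozen_orbit_loses_aux hN h12 h2N P x hx hF 1 1 (Or.inl rfl) (Or.inl rfl)
      (fun i hi => by rw [if_neg (by have := hG i hi; omega)])
      (fun i hi => by rw [if_neg (by have := hG i hi; omega)])
  · exact frozen_orbit_loses_aux hN h12 h2N P x hx hF 2 1 (Or.inr rfl) (Or.inl rfl)
      (fun i hi => by rw [if_pos (hG i hi).1])
      (fun i hi => by rw [if_neg (by have := (hG i hi).2; omega)])
  · exact frozen_orbit_loses_aux hN h12 h2N P x hx hF 2 2 (Or.inr rfl) (Or.inr rfl)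
      (fun i hi => by rw [if_pos (by have := hG i hi; omega)])
      (fun i hi => by rw [if_pos (hG i hi)])

/-- **THE FROZEN LAW (counting)**: the losing part of the odd class is at least a quarter of its frozen one-gap part. -/
theorem frozen_loss_count (hN : 3 ≤ N) {a₁ a₂ : ℕ} (h12 : a₁ + 2 ≤ a₂) (h2N : a₂ + 3 ≤ N)
    (P : Fin N → CubeFn (ZMod 3) N) :
    (univ.filter fun x : Fin N → Bool => OddZeros x ∧ Frozen P a₁ a₂ x ∧ OneGap P a₁ a₂ x).card ≤
      4 * (univ.filter fun x : Fin N → Bool => OddZeros x ∧ ¬ Rel x (outB P x)).card := by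
  set L := univ.filter fun x : Fin N → Bool => OddZeros x ∧ ¬ Rel x (outB P x) with hL
  set L₁ := univ.filter fun x : Fin N → Bool =>
    OddZeros x ∧ ¬ Rel (flip2 a₁ (a₁ + 1) x) (outB P (flip2 a₁ (a₁ + 1) x)) with hL₁
  set L₂ := univ.filter fun x : Fin N → Bool =>
    OddZeros x ∧ ¬ Rel (flip2 a₂ (a₂ + 1) x) (outB P (flip2 a₂ (a₂ + 1) x)) with hL₂
  set L₃ := univ.filter fun x : Fin N → Bool => OddZeros x ∧
    ¬ Rel (flip2 a₁ (a₁ + 1) (flip2 a₂ (a₂ + 1) x)) (outB P (flip2 a₁ (a₁ + 1) (flip2 a₂ (a₂ + 1) x))) with hL₃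
  have c₁ : L₁.card = L.card :=
    card_filter_flip2 (a := a₁) (b := a₁ + 1) (by omega) (by omega) (fun y => ¬ Rel y (outB P y))
  have c₂ : L₂.card = L.card :=
    card_filter_flip2 (a := a₂) (b := a₂ + 1) (by omega) (by omega) (fun y => ¬ Rel y (outB P y))
  have c₃ : L₃.card = L₁.card :=
    card_filter_flip2 (a := a₂) (b := a₂ + 1) (by omega) (by omega)
      (fun y => ¬ Rel (flip2 a₁ (a₁ + 1) y) (outB P (flip2 a₁ (a₁ + 1) y)))
  have c₃' : L₃.card = L.card := c₃.trans c₁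
  have hsub : (univ.filter fun x : Fin N → Bool => OddZeros x ∧ Frozen P a₁ a₂ x ∧ OneGap P a₁ a₂ x) ⊆
      L ∪ L₁ ∪ L₂ ∪ L₃ := by
    intro x hx
    rw [mem_filter] at hx
    obtain ⟨-, hodd, hF, hG⟩ := hx
    have h := frozen_orbit_loses hN h12 h2N P x hodd hF hG
    simp only [mem_union, hL, hL₁, hL₂, hL₃, mem_filter, mem_univ, true_and]
    tauto
  calc (univ.filter fun x : Fin N → Bool => OddZeros x ∧ Frozen P a₁ a₂ x ∧ OneGap P a₁ a₂ x).card
      ≤ (L ∪ L₁ ∪ L₂ ∪ L₃).card := card_le_card hsub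
    _ ≤ L.card + L₁.card + L₂.card + L₃.card := by
        refine (card_union_le _ _).trans ?_
        refine Nat.add_le_add_right ((card_union_le _ _).trans (Nat.add_le_add_right (card_union_le _ _) _)) _
    _ = 4 * L.card := by rw [c₁, c₂, c₃']; ring

end Frozen

/-! ## §5 Dictionary: why the anchor's parity bit REFLECTS the avoided value (forcing the fourth flip) -/

section Reflection

/-- the RELATIVE PHASE of the `j`-th window position read with entrance parity `u` over the local zero-parities `π`:
`ρ_j(u) = j + #{i < j : u ⊕ π_i}` (this is `c_{k+j} - c_k` at anchor `k`, with `u = zpar x k`). -/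
def relPhase (π : ℕ → Bool) (u : Bool) (j : ℕ) : ZMod 3 :=
  (j : ZMod 3) + (((range j).filter fun i => xor u (π i) = true).card : ZMod 3)

/-- **reflection law**: flipping the hidden entrance bit NEGATES every relative phase (`3j ≡ 0`). -/
theorem relPhase_not (π : ℕ → Bool) (u : Bool) (j : ℕ) : relPhase π (!u) j = - relPhase π u j := by
  unfold relPhase
  have hc : ((range j).filter fun i => xor (!u) (π i) = true).card +
      ((range j).filter fun i => xor u (π i) = true).card = j := by
    have h := card_filter_add_card_filter_not (s := range j) (fun i => xor u (π i) = true)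
    rw [card_range] at h
    have e : ((range j).filter fun i => ¬ xor u (π i) = true) = (range j).filter fun i => xor (!u) (π i) = true :=
      filter_congr fun i _ => by cases u <;> cases π i <;> simp
    rw [e] at h
    omega
  have h3 : (3 : ZMod 3) = 0 := by decide
  have hj : ((((range j).filter fun i => xor (!u) (π i) = true).card : ℕ) : ZMod 3) =
      (j : ZMod 3) - (((range j).filter fun i => xor u (π i) = true).card : ZMod 3) := by
    rw [eq_sub_iff_add_eq, ← Nat.cast_add, hc]
  rw [hj]
  linear_combination (j : ZMod 3) * h3

/-- hence a window bet that wins iff `#{j ∈ d : τ + ρ_j(u) ≢ 2}` is odd has its LOSING set of hidden trits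
reflected, `A(ū) = 1 - A(u)`: the avoided value is known only up to `a ↦ 1 - a` when `u` is hidden — the datum
the four-flip core (§4, `Compat₂ 1`) is built for. -/
theorem win_reflect {α : Type*} (d : Finset α) (ρ : α → ZMod 3) (τ : ZMod 3) :
    (d.filter fun j => τ + -ρ j ≠ 2) = d.filter fun j => (1 - τ) + ρ j ≠ 2 := by
  have h3 : (3 : ZMod 3) = 0 := by decide
  refine filter_congr fun j _ => ?_
  constructor
  · intro h h'; apply h; linear_combination (-1 : ZMod 3) * h' - h3
  · intro h h'; apply h; linear_combination (-1 : ZMod 3) * h' - h3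

end Reflection

/-! ## §6 Barrier notes (recorded, not pieces): the GAUGE freedom of deviation sets

* NULL PAIRS.  If the relative phase `ρ_j(0)` of two positions `k, k+j` is `0` (a condition on the `j+1` local bits,
  degree `O(j)`), then `c_k = c_{k+j}` for BOTH values of the hidden bit (`relPhase_not`), so toggling the output at
  both positions changes the winning count by `0` or `±2`: wins are preserved EXACTLY.  Planting such pairs far from
  a window makes any strategy «wide» at no cost; planting them at a position steered by a degree-2 `MOD₃` of far bits
  makes the least deviation «unstable» under a constant fraction of pair-flips.  Hence every class cut by deviation
  WIDTH or by the FINE position of the least deviation has a complement cheaply enterable from everywhere: `≡ T`.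
* COVARIANT SLIDES.  A window bet can be re-encoded `s = O(1)` positions further (phases shift by the locally known
  `ρ_s`, the sign rule `u' = u ⊕ π` is absorbed by `M ↦ ±M`), win function unchanged a.e.: fine anchor position is
  gauge.  Slides by `s ≫ (log n)^c` need the hidden parity count over the gap — a `MOD₃ ∘ XOR`, g13's decode law.
* CONSTANT PARITY IS ZERO.  For a multiset `R ⊂ 𝔽₃` of relative phases, `τ ↦ #{r ∈ R : τ + r ≢ 2} mod 2` is
  constant iff the three multiplicities have equal parity, and then the constant is `0`: no locally determined set
  of positions flips a bet's outcome for free (else the canonical strategy would win on the odd class).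
  Consequence: the only win-preserving cheap recodings are null toggles and short slides, and the CERTIFICATE
  `(A, f)` of `MovingPointerLoss3` is invariant under both — which is why the crux is stated over certificates.
-/

end Summit.QuantumAdvantage.QuantumAdvantage.Theorems.AnchorDial

end
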